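import Mathlib
import HarnessLib
import Summits.NavierStokesRegularity.NavierStokesRegularity.Theorems.PoloidalWindowDoorPoloidalWindowRigidityFourierKernels

/-!
# Theorem A, Fourier side: the real annular kernels `φ_{ε,N}`, `K_j` and the reproduction identity

Seat ns-poloidal-K2-p2 g6 (interim lead-of-record on crux K2 `PoloidalWindowRigidity` = stmt-NavierStokesRegularity-19708;
line `mixed_type` v1; item stmt-20428 `LrcModEntire`).  File 4a′ of the Lean port of **Theorem A** of memo
TH-ELLIPTIC-LIOUVILLE-g6.  From File 4a (`…FourierKernels`: `Φ = 𝓕⁻¹A_{ε,N}`, `𝒦_j = 𝓕⁻¹B_j`, the complex identity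
`Φ = ∑_j 𝒦_j ⋆ ∂_jΦ`, realness of `Φ`) we pass to the REAL kernels

  `kerφ = Re Φ`,  `kerK j = Re 𝒦_j`,

record their smoothness / integrability / boundedness and the weighted integrability `∫ |K_j| (1 + ‖y‖²)² < ∞`
(Schwartz decay; this is the hypothesis of File 3 `…WeightedYoung`), and prove the real **reproduction identity**

* `kerφ_eq_sum` — `φ(x) = ∑_j ∫ K_j(y) · ∂_{b_j} φ(x − y) dy`. [folklore]

Consumers: File 4b (reverse Poincaré inequality for `g ⋆ φ_{ε,N}`), File 4c (Theorem A).
WHAT THIS IS NOT: not a claim about Navier–Stokes — harmonic-analysis plumbing for a kinematic Liouville mechanism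
(bears_on LADDER-NS N0 via crux K2 = stmt-19708 / item 20428, mixed_type `stub_semiElliptic` ∩ (TH)).
-/

-- the summit and its single sub-problem share the name (CONVENTIONS §1)
set_option linter.dupNamespace false

noncomputable section

namespace Summit.NavierStokesRegularity.NavierStokesRegularity.Theorems.PoloidalWindowDoorPoloidalWindowRigidityRealKernels

open Set Function Filter Topology MeasureTheory SchwartzMap Complex Real InnerProductSpace
open scoped RealInnerProductSpace FourierTransform LineDeriv ComplexConjugate
open Summit.NavierStokesRegularity.NavierStokesRegularity.Theorems.PoloidalWindowDoorPoloidalWindowRigidityFourierKernels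

variable (V : Type*) [NormedAddCommGroup V] [InnerProductSpace ℝ V] [FiniteDimensional ℝ V]
  [MeasurableSpace V] [BorelSpace V] {ε N : ℝ}

/-! ### The real kernels -/

/-- The real kernel `φ_{ε,N} = Re Φ_{ε,N}`. -/
def kerφ (hε : 0 < ε) (hN : ε < N) : V → ℝ := fun x => (PhiS V hε hN x).re

variable {V}

variable (V) in
/-- The real kernels `K_v = Re 𝒦_v`. -/
def kerK (hε : 0 < ε) (hN : ε < N) (v : V) : V → ℝ := fun y => (KS V hε hN v y).re

/-- `Φ = φ` (as complex numbers). -/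
theorem ofReal_kerφ (hε : 0 < ε) (hN : ε < N) (x : V) : (kerφ V hε hN x : ℂ) = PhiS V hε hN x :=
  ofReal_re_PhiS hε hN x

/-- `φ_{ε,N}` is smooth. -/
theorem contDiff_kerφ (hε : 0 < ε) (hN : ε < N) {n : ℕ∞} : ContDiff ℝ n (kerφ V hε hN) :=
  Complex.reCLM.contDiff.comp ((PhiS V hε hN).smooth n)

/-- `φ_{ε,N}` is continuous. -/
theorem continuous_kerφ (hε : 0 < ε) (hN : ε < N) : Continuous (kerφ V hε hN) :=
  (contDiff_kerφ hε hN (n := 0)).continuous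

/-- `φ_{ε,N}` is integrable. -/
theorem integrable_kerφ (hε : 0 < ε) (hN : ε < N) : Integrable (kerφ V hε hN) :=
  ((PhiS V hε hN).integrable (μ := (volume : Measure V))).re

/-- `φ_{ε,N}` is differentiable. -/
theorem differentiable_kerφ (hε : 0 < ε) (hN : ε < N) : Differentiable ℝ (kerφ V hε hN) :=
  Complex.reCLM.differentiable.comp (PhiS V hε hN).differentiable

/-- The derivative of `φ` is the real part of the derivative of `Φ`. -/
theorem fderiv_kerφ (hε : 0 < ε) (hN : ε < N) (x v : V) :
    fderiv ℝ (kerφ V hε hN) x v = (fderiv ℝ (⇑(PhiS V hε hN)) x v).re := by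
  have : kerφ V hε hN = Complex.reCLM ∘ ⇑(PhiS V hε hN) := rfl
  rw [this, fderiv_comp x Complex.reCLM.differentiableAt ((PhiS V hε hN).differentiableAt),
    Complex.reCLM.fderiv]
  rfl

/-- The derivative of `Φ` is the (complexified) derivative of `φ`. -/
theorem ofReal_fderiv_kerφ (hε : 0 < ε) (hN : ε < N) (x v : V) :
    ((fderiv ℝ (kerφ V hε hN) x v : ℝ) : ℂ) = fderiv ℝ (⇑(PhiS V hε hN)) x v := by
  have h : ⇑(PhiS V hε hN) = Complex.ofRealCLM ∘ kerφ V hε hN := funext fun y => (ofReal_kerφ hε hN y).symm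
  rw [h, fderiv_comp x Complex.ofRealCLM.differentiableAt (differentiable_kerφ hε hN x),
    Complex.ofRealCLM.fderiv]
  rfl

/-- `∂_v φ_{ε,N}` is the real part of the Schwartz function `∂_v Φ`. -/
theorem fderiv_kerφ_eq_re_lineDeriv (hε : 0 < ε) (hN : ε < N) (v : V) :
    (fun s => fderiv ℝ (kerφ V hε hN) s v) = fun s => ((∂_{v} (PhiS V hε hN)) s).re := by
  ext s
  rw [fderiv_kerφ, lineDerivOp_apply_eq_fderiv]

/-- `∂_v φ_{ε,N}` is integrable. -/
theorem integrable_fderiv_kerφ (hε : 0 < ε) (hN : ε < N) (v : V) :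
    Integrable fun s => fderiv ℝ (kerφ V hε hN) s v := by
  rw [fderiv_kerφ_eq_re_lineDeriv]
  exact ((∂_{v} (PhiS V hε hN)).integrable (μ := (volume : Measure V))).re

/-- `∂_v φ_{ε,N}` is continuous. -/
theorem continuous_fderiv_kerφ (hε : 0 < ε) (hN : ε < N) (v : V) :
    Continuous fun s => fderiv ℝ (kerφ V hε hN) s v := by
  rw [fderiv_kerφ_eq_re_lineDeriv]
  exact Complex.continuous_re.comp (∂_{v} (PhiS V hε hN)).continuous

/-- `Dφ_{ε,N}` is bounded. -/
theorem exists_bound_fderiv_kerφ (hε : 0 < ε) (hN : ε < N) : ∃ C, ∀ x, ‖fderiv ℝ (kerφ V hε hN) x‖ ≤ C := by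
  refine ⟨SchwartzMap.seminorm ℝ 0 0 (fderivCLM ℝ V ℂ (PhiS V hε hN)), fun x => ?_⟩
  have h1 : fderiv ℝ (kerφ V hε hN) x = Complex.reCLM.comp (fderiv ℝ (⇑(PhiS V hε hN)) x) := by
    ext v; exact fderiv_kerφ hε hN x v
  rw [h1]
  refine (ContinuousLinearMap.opNorm_comp_le _ _).trans ?_
  refine (mul_le_of_le_one_left (norm_nonneg _) Complex.reCLM_norm.le).trans ?_
  have := norm_le_seminorm ℝ (fderivCLM ℝ V ℂ (PhiS V hε hN)) x
  rwa [fderivCLM_apply] at this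

/-- `K_v` is continuous. -/
theorem continuous_kerK (hε : 0 < ε) (hN : ε < N) (v : V) : Continuous (kerK V hε hN v) :=
  Complex.continuous_re.comp (KS V hε hN v).continuous

/-- `K_v` is integrable. -/
theorem integrable_kerK (hε : 0 < ε) (hN : ε < N) (v : V) : Integrable (kerK V hε hN v) :=
  ((KS V hε hN v).integrable (μ := (volume : Measure V))).re

/-- `|K_v| (1 + ‖y‖²)²` is integrable (Schwartz decay). -/
theorem integrable_kerK_weight (hε : 0 < ε) (hN : ε < N) (v : V) :
    Integrable fun y => |kerK V hε hN v y| * (1 + ‖y‖ ^ 2) ^ 2 := by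
  set f := KS V hε hN v
  have h0 : Integrable (fun y => ‖f y‖) (volume : Measure V) := f.integrable.norm
  have h2 := f.integrable_pow_mul (volume : Measure V) 2
  have h4 := f.integrable_pow_mul (volume : Measure V) 4
  have hsum : Integrable (fun y => ‖f y‖ * (1 + ‖y‖ ^ 2) ^ 2) (volume : Measure V) := by
    have : (fun y => ‖f y‖ * (1 + ‖y‖ ^ 2) ^ 2)
        = fun y => ‖f y‖ + 2 * (‖y‖ ^ 2 * ‖f y‖) + ‖y‖ ^ 4 * ‖f y‖ := by
      ext y; ring
    rw [this]
    exact (h0.add (h2.const_mul 2)).add h4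
  refine hsum.mono' (((continuous_kerK hε hN v).abs).mul (by fun_prop)).aestronglyMeasurable
    (Eventually.of_forall fun y => ?_)
  rw [Real.norm_eq_abs, abs_mul, abs_abs, abs_of_nonneg (by positivity : (0 : ℝ) ≤ (1 + ‖y‖ ^ 2) ^ 2)]
  exact mul_le_mul_of_nonneg_right (Complex.abs_re_le_norm _) (by positivity)

/-- **THE REPRODUCTION IDENTITY.**  `φ_{ε,N}(x) = ∑_j ∫ K_{b_j}(y) · ∂_{b_j} φ_{ε,N}(x − y) dy`. [folklore] -/
theorem kerφ_eq_sum (hε : 0 < ε) (hN : ε < N) (x : V) :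
    kerφ V hε hN x = ∑ j, ∫ y, kerK V hε hN (stdOrthonormalBasis ℝ V j) y *
      fderiv ℝ (kerφ V hε hN) (x - y) (stdOrthonormalBasis ℝ V j) := by
  have h := PhiS_eq_sum hε hN x
  simp_rw [lineDerivOp_apply_eq_fderiv, ← ofReal_fderiv_kerφ] at h
  have hi : ∀ j, Integrable (fun y => KS V hε hN (stdOrthonormalBasis ℝ V j) y *
      ((fderiv ℝ (kerφ V hε hN) (x - y) (stdOrthonormalBasis ℝ V j) : ℝ) : ℂ)) (volume : Measure V) := by
    intro j
    obtain ⟨C, hC⟩ := exists_bound_fderiv_kerφ (V := V) hε hN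
    refine ((KS V hε hN _).integrable (μ := (volume : Measure V))).mul_bdd (c := C * ‖stdOrthonormalBasis ℝ V j‖)
      ?_ (Eventually.of_forall fun y => ?_)
    · exact (Complex.continuous_ofReal.comp ((continuous_fderiv_kerφ hε hN _).comp
        (continuous_const.sub continuous_id))).aestronglyMeasurable
    · rw [Complex.norm_real]
      exact (ContinuousLinearMap.le_opNorm _ _).trans (mul_le_mul_of_nonneg_right (hC _) (norm_nonneg _))
  show (PhiS V hε hN x).re = _
  rw [h, Complex.re_sum]
  refine Finset.sum_congr rfl fun j _ => ?_
  have hre := integral_re (hi j)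
  simp only [RCLike.re_eq_complex_re] at hre
  rw [← hre]
  congr 1
  ext y
  simp [kerK]


end Summit.NavierStokesRegularity.NavierStokesRegularity.Theorems.PoloidalWindowDoorPoloidalWindowRigidityRealKernels

end
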